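import Literature.MathematicalPhysics.QuantumFieldTheory.Balaban1983to89.Beta.ScalarBlockKKT
import Literature.MathematicalPhysics.QuantumFieldTheory.Balaban1983to89.Beta.KKTFluctuationEnergy
import Literature.MathematicalPhysics.QuantumFieldTheory.Balaban1983to89.Beta.KKTFluctuationUnique

/-!
# `Balaban1983to89.Beta.ScalarBlockGreen` — THE SCALAR BLOCK-CONSTRAINED GREEN KERNEL `Gs` of `Beta/ScalarBlockKKT`
IS SYMMETRIC, POSITIVE-SEMIDEFINITE AND CANONICAL: the energy identity `Gs(x', x'') = ⟨dz G_{x''}, dz G_{x'}⟩`, and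
uniqueness of tempered solutions of the scalar KKT system (β sub-cell row BETA-an2, unit `b2b-balaban-beta-an2` gen 6;
AN2.md §14.4 brick (G′), second half)

HONEST FRAMING (cell `pub-balaban`, verbatim): discharging `BetaPertH` makes Bałaban's UV stability UNCONDITIONAL — a
real constructive-QFT result; it is NOT the continuum limit and NOT the Clay problem.  This module is [folklore] lattice
analysis on landed machinery; it asserts NOTHING about Bałaban's papers, contains no `def … : Prop` fact, cites
no published theorem as a hypothesis, and is NOT summit progress.  ABSOLUTE RULE honoured: nothing is cited; everything
is proved.

## What is here

For the Green kernel `Gs x x'` / multiplier `Ws y x'` of `Beta/ScalarBlockKKT` (the tempered solution of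
(ELₛ) `codiff₁ (dz λ) = ω ∘ quo N + δ_{x'}`, (Mₛ) `blockSum N λ = 0` on `ℤ^{d+1}`, at FIXED `N`):

* §1 toolkit additions to `Beta/KKTFluctuationEnergy` (`lip1_comm`, `lip0_comm`, `lip0_add`, `lip1_sum_left/right`);
* §2 the columns `GsCol x' := Gs(·, x')`, the pulled-back multiplier `WsAdj x'` (block-constant, `isBlockConst_WsAdj`),
  the force `δS x'`; (ELₛ) as `lapN_GsCol`, (Mₛ) as `blockSum_GsCol`; uniform bounds and summability from the decay;
* §3 the three pairings — M/G COMPLEMENTARITY `⟨G_{x''}, WsAdj x'⟩ = 0` (block-constant ⟂ zero block sums,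
  `KKTFluctuationEnergy.tsum_mul_eq_zero_of_blockConst`), `⟨G_{x''}, δ_{x'}⟩ = Gs(x', x'')`, and the adjointness
  `⟨f, codiff₁ B⟩ = ⟨dz f, B⟩` — giving **THE ENERGY IDENTITY** `Gs_eq_lip1 : Gs x' x'' = lip1 (dz G_{x''}) (dz G_{x'})`,
  hence `Gs_symm`, `Gs_self_eq`, `Gs_self_nonneg` and **`Gs_psd`** (every finite quadratic form in `Gs` is `‖dz W‖² ≥ 0`);
* §4 the scalar system `SolvesS N F c λ ω`, block configurations `cfgOfS`, the identification of the block operator with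
  `FibreLiouville.stencilApply (stencil (d+1)) pieceMatrixS` and **`unique_of_solvesS`**: two TEMPERED pairs solving the
  system with the same data coincide (polynomial Liouville, `FibreLiouville.eq_of_stencilApply_eq`, fed by
  `ScalarBlockKKT.det_trigPolySymbolS_ne_zero`);
* §5 **`eq_GsCol_of_solvesS`**: `(G_{x'}, W_{x'})` is THE tempered solution with the unit force at `x'` and zero block
  sums — the kernel is canonical (representation-independent), whatever closed formula one prefers for it.

NOT here: strict positivity on fluctuation fields; any `N`-uniform bound; the READING of `Gs` against the printed
scalar covariance operators of [Balaban1985BackgroundPropagators] §3 (AN2.md, markdown only, never cited).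
-/

namespace Literature.MathematicalPhysics.QuantumFieldTheory.Balaban1983to89.Beta.ScalarBlockGreen

noncomputable section

open Literature.Probability.LatticeModels (TorusSite Torus.proj Torus.proj_apply)
open AffineAveraging (Form0 Form1 unitVec unitVec_apply dz codiff₁ box toSite blockSum)
open AffineReproduction (IsBlockConst)
open LatticeForm (repZ quo proj_repZ)
open BlochFibreUniqueness (quo_add_zsmul quo_repZ)
open BlochFibreMatrix (repZ_zero)
open BlochFibreMatrix (stencil eq_repZ_add_zsmul_quo)
open FibreLiouville (PolyBdd stencilApply eq_of_stencilApply_eq one_le_one_add_l1)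
open KKTFluctuationEnergy (lip0 lip1 summable_mul_of_bdd summable_mul_of_bdd' summable_of_exp_bound
  abs_le_of_exp_bound summable_dz abs_dz_le lip0_codiff₁ tsum_mul_eq_zero_of_blockConst quo_zsmul_add_toSite)
open KKTFluctuationUnique (ofR0 ofR1 ofR0_apply dz_ofR0 codiff₁_ofR1 blockSum_ofR0 Tempered0 Tempered0.of_bounded
  one_add_l1_fine_le abs_le_of_decay510)
open ScalarBlockKKT (IdxS CfgS cfgL cfgW cfgFunS shiftCfgS pieceMatrixS cfgFunS_shiftCfgS_eq_sum cfgFunS_shiftCfgS_inl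
  cfgFunS_shiftCfgS_inr det_trigPolySymbolS_ne_zero gS wS Gs Ws Gs_EL Gs_M decay_Gs decay_wS)
open B12Sec2to5 (l1 l1_nonneg Decay510)

variable {D d N : ℕ}

/-! ## §1 Toolkit additions: symmetry and linearity of the pairings -/

section Toolkit

/-- `lip1` is symmetric. [folklore] -/
theorem lip1_comm (A B : Form1 D ℝ) : lip1 A B = lip1 B A :=
  tsum_congr fun _ => Finset.sum_congr rfl fun _ _ => mul_comm _ _

/-- `lip0` is symmetric. [folklore] -/
theorem lip0_comm (f g : Form0 D ℝ) : lip0 f g = lip0 g f :=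
  tsum_congr fun _ => mul_comm _ _

/-- `lip0` is additive in the second slot under summability of both pairings. [folklore] -/
theorem lip0_add {f g h : Form0 D ℝ} (hg : Summable (fun x => f x * g x)) (hh : Summable (fun x => f x * h x)) :
    lip0 f (g + h) = lip0 f g + lip0 f h := by
  unfold lip0
  simp only [Pi.add_apply, mul_add]
  exact hg.tsum_add hh

/-- `lip1` of a finite linear combination in the first slot, under summability of each pairing. [folklore] -/
theorem lip1_sum_left {ι : Type*} (S : Finset ι) (c : ι → ℝ) (A : ι → Form1 D ℝ) (B : Form1 D ℝ)
    (h : ∀ i ∈ S, ∀ μ, Summable (fun x => A i μ x * B μ x)) :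
    lip1 (fun μ x => ∑ i ∈ S, c i * A i μ x) B = ∑ i ∈ S, c i * lip1 (A i) B := by
  unfold lip1
  have e : ∀ x : AffineAveraging.Site D, ∑ μ, (∑ i ∈ S, c i * A i μ x) * B μ x
      = ∑ i ∈ S, c i * ∑ μ, A i μ x * B μ x := by
    intro x
    simp only [Finset.sum_mul, mul_assoc, Finset.mul_sum]
    exact Finset.sum_comm
  refine (tsum_congr e).trans ?_
  rw [Summable.tsum_finsetSum (fun i hi => (summable_sum fun μ _ => h i hi μ).mul_left (c i))]
  exact Finset.sum_congr rfl fun i _ => tsum_mul_left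

/-- `lip1` of a finite linear combination in the second slot. [folklore] -/
theorem lip1_sum_right {ι : Type*} (S : Finset ι) (c : ι → ℝ) (A : ι → Form1 D ℝ) (B : Form1 D ℝ)
    (h : ∀ i ∈ S, ∀ μ, Summable (fun x => B μ x * A i μ x)) :
    lip1 B (fun μ x => ∑ i ∈ S, c i * A i μ x) = ∑ i ∈ S, c i * lip1 B (A i) := by
  rw [lip1_comm, lip1_sum_left S c A B (fun i hi μ => by
    have h' := h i hi μ
    simpa only [mul_comm] using h')]
  exact Finset.sum_congr rfl fun i _ => by rw [lip1_comm]

end Toolkit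

/-! ## §2 The columns of the scalar Green kernel and their (ELₛ)/(Mₛ) identities -/

section Columns

variable [NeZero N]

/-- The column `G_{x'} := Gs(·, x')` as a fine 0-form. [folklore] -/
def GsCol (x' : AffineAveraging.Site (d + 1)) : Form0 (d + 1) ℝ := fun z => Gs (N := N) z x'

/-- Its multiplier pulled back to the fine lattice: `x ↦ Ws (quo N x) x'` (block-constant). [folklore] -/
def WsAdj (x' : AffineAveraging.Site (d + 1)) : Form0 (d + 1) ℝ := fun x => Ws (N := N) (quo N x) x'

/-- The unit force `δ_{x'}`. [folklore] -/
def δS (x' : AffineAveraging.Site (d + 1)) : Form0 (d + 1) ℝ := fun x => if x = x' then 1 else 0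

/-- (ELₛ) for the column, as an identity of 0-forms: `codiff₁ (dz G_{x'}) = WsAdj x' + δ_{x'}`. [folklore] -/
theorem lapN_GsCol (x' : AffineAveraging.Site (d + 1)) :
    codiff₁ (dz (GsCol (N := N) x')) = WsAdj (N := N) x' + δS x' := by
  funext x
  exact Gs_EL (N := N) x' x

/-- (Mₛ) for the column: zero block sums. [folklore] -/
theorem blockSum_GsCol (x' y : AffineAveraging.Site (d + 1)) : blockSum N (GsCol (N := N) x') y = 0 :=
  Gs_M (N := N) x' y

/-- Uniform bound and summability of the columns (from `decay_Gs`, at fixed `N`). [folklore] -/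
theorem GsCol_bdd_summable : ∃ C : ℝ, 0 ≤ C ∧ (∀ (x' x : AffineAveraging.Site (d + 1)), |GsCol (N := N) x' x| ≤ C)
    ∧ ∀ (x' : AffineAveraging.Site (d + 1)), Summable (GsCol (N := N) x') := by
  obtain ⟨δ, C, hδ, hC, h⟩ := decay_Gs (N := N) (d := d)
  exact ⟨C, hC, fun x' x => abs_le_of_exp_bound hδ hC x' (fun z => h z x') x,
    fun x' => summable_of_exp_bound hδ x' (fun z => h z x')⟩

/-- Uniform bound of the pulled-back multipliers (from `decay_wS`). [folklore] -/
theorem WsAdj_bdd : ∃ C : ℝ, 0 ≤ C ∧ ∀ (x' x : AffineAveraging.Site (d + 1)), |WsAdj (N := N) x' x| ≤ C := by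
  obtain ⟨δ, C, hδ, hC, h⟩ := decay_wS (N := N) (d := d)
  refine ⟨C, hC, fun x' x => ?_⟩
  have hz : |WsAdj (N := N) x' x| ≤ C * Real.exp (-δ * l1 (quo N x - quo N x')) :=
    h (Torus.proj N x') (quo N x - quo N x')
  have he : Real.exp (-δ * l1 (quo N x - quo N x')) ≤ 1 := by
    rw [Real.exp_le_one_iff]
    nlinarith [l1_nonneg (quo N x - quo N x')]
  nlinarith

/-- The pulled-back multiplier is block-constant. [folklore] -/
theorem isBlockConst_WsAdj (x' : AffineAveraging.Site (d + 1)) : IsBlockConst N (WsAdj (N := N) x') := by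
  intro y b hb
  have hq0 : quo N (0 : AffineAveraging.Site (d + 1)) = 0 := by
    have := quo_repZ (N := N) (0 : TorusSite (d + 1) N); rwa [repZ_zero] at this
  have hqy : quo N ((N : ℤ) • y) = y := by
    have := quo_add_zsmul (N := N) (0 : AffineAveraging.Site (d + 1)) y
    rwa [zero_add, hq0, zero_add] at this
  simp only [WsAdj]
  rw [quo_zsmul_add_toSite y hb, hqy]

end Columns

/-! ## §3 The three pairings and THE ENERGY IDENTITY `Gs(x', x'') = ⟨dz G_{x''}, dz G_{x'}⟩` -/

section Energy

variable [NeZero N]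

/-- The multiplier term pairs to zero with every column (M/G complementarity: block-constant ⟂ zero block sums).
[folklore] -/
theorem lip0_GsCol_WsAdj (x' x'' : AffineAveraging.Site (d + 1)) :
    lip0 (GsCol (N := N) x'') (WsAdj (N := N) x') = 0 := by
  obtain ⟨C, _, _, hsum⟩ := GsCol_bdd_summable (N := N) (d := d)
  obtain ⟨CW, _, hW⟩ := WsAdj_bdd (N := N) (d := d)
  rw [lip0_comm]
  unfold lip0
  exact tsum_mul_eq_zero_of_blockConst (N := N) (hW x') (isBlockConst_WsAdj (N := N) x') (hsum x'')
    (blockSum_GsCol (N := N) x'')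

/-- The force term pairs to the kernel entry: `⟨G_{x''}, δ_{x'}⟩ = Gs(x', x'')`. [folklore] -/
theorem lip0_GsCol_δS (x' x'' : AffineAveraging.Site (d + 1)) :
    lip0 (GsCol (N := N) x'') (δS x') = Gs (N := N) x' x'' := by
  unfold lip0
  have e : ∀ x, GsCol (N := N) x'' x * δS x' x = if x = x' then Gs (N := N) x' x'' else 0 := by
    intro x
    by_cases hx : x = x'
    · subst hx
      simp [δS, GsCol]
    · simp [δS, hx]
  rw [tsum_congr e, tsum_eq_single x' (fun x hx => if_neg hx), if_pos rfl]

/-- **THE ENERGY IDENTITY.**  `Gs(x', x'') = ⟨dz G_{x''}, dz G_{x'}⟩_{ℤ^{d+1}}`. [folklore] -/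
theorem Gs_eq_lip1 (x' x'' : AffineAveraging.Site (d + 1)) :
    Gs (N := N) x' x'' = lip1 (dz (GsCol (N := N) x'')) (dz (GsCol (N := N) x')) := by
  obtain ⟨C, _, hbdd, hsum⟩ := GsCol_bdd_summable (N := N) (d := d)
  obtain ⟨CW, _, hW⟩ := WsAdj_bdd (N := N) (d := d)
  rw [← lip0_codiff₁ (hbdd x'') (fun κ => summable_dz (hsum x') κ), lapN_GsCol]
  have s1 : Summable (fun x => GsCol (N := N) x'' x * WsAdj (N := N) x' x) :=
    summable_mul_of_bdd' (hsum x'') (hW x')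
  have s2 : Summable (fun x => GsCol (N := N) x'' x * δS x' x) :=
    summable_mul_of_bdd' (M := 1) (hsum x'') (fun x => by
      unfold δS
      split_ifs <;> simp)
  rw [lip0_add s1 s2, lip0_GsCol_WsAdj, lip0_GsCol_δS, zero_add]

/-- **SYMMETRY OF THE SCALAR GREEN KERNEL**: `Gs(x', x'') = Gs(x'', x')`. [folklore] -/
theorem Gs_symm (x' x'' : AffineAveraging.Site (d + 1)) : Gs (N := N) x' x'' = Gs (N := N) x'' x' := by
  rw [Gs_eq_lip1, Gs_eq_lip1, lip1_comm]

/-- The diagonal is an energy: `Gs(x', x') = ∑'_x ∑_μ ((dz G_{x'})_μ(x))²`. [folklore] -/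
theorem Gs_self_eq (x' : AffineAveraging.Site (d + 1)) :
    Gs (N := N) x' x' = ∑' x, ∑ μ, (dz (GsCol (N := N) x') μ x) ^ 2 := by
  rw [Gs_eq_lip1]
  unfold lip1
  refine tsum_congr (fun x => Finset.sum_congr rfl (fun μ _ => ?_))
  ring

/-- **POSITIVITY OF THE DIAGONAL**: `0 ≤ Gs(x', x')`. [folklore] -/
theorem Gs_self_nonneg (x' : AffineAveraging.Site (d + 1)) : 0 ≤ Gs (N := N) x' x' := by
  rw [Gs_self_eq]
  exact tsum_nonneg fun x => Finset.sum_nonneg fun μ _ => sq_nonneg _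

/-- A finite linear combination of columns `W = ∑_{b ∈ S} a_b G_b`. [folklore] -/
def GsColSum (S : Finset (AffineAveraging.Site (d + 1))) (a : AffineAveraging.Site (d + 1) → ℝ) : Form0 (d + 1) ℝ :=
  fun x => ∑ b ∈ S, a b * GsCol (N := N) b x

/-- `dz` is linear on finite combinations of columns. [folklore] -/
theorem dz_GsColSum (S : Finset (AffineAveraging.Site (d + 1))) (a : AffineAveraging.Site (d + 1) → ℝ) :
    dz (GsColSum (N := N) S a) = fun μ x => ∑ b ∈ S, a b * dz (GsCol (N := N) b) μ x := by
  funext μ x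
  simp only [dz, GsColSum]
  rw [← Finset.sum_sub_distrib]
  refine Finset.sum_congr rfl fun b _ => ?_
  ring

/-- **POSITIVE-SEMIDEFINITENESS OF THE SCALAR GREEN KERNEL**: every finite quadratic form in `Gs` is the energy
`‖dz W‖²` of the corresponding combination of columns, hence `≥ 0`. [folklore] -/
theorem Gs_psd (S : Finset (AffineAveraging.Site (d + 1))) (a : AffineAveraging.Site (d + 1) → ℝ) :
    0 ≤ ∑ b ∈ S, ∑ b' ∈ S, a b * a b' * Gs (N := N) b b' := by
  obtain ⟨C, hC, hbdd, hsum⟩ := GsCol_bdd_summable (N := N) (d := d)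
  have hWb : ∀ x, |GsColSum (N := N) S a x| ≤ ∑ b ∈ S, |a b| * C := fun x => by
    simp only [GsColSum]
    calc |∑ b ∈ S, a b * GsCol (N := N) b x| ≤ ∑ b ∈ S, |a b * GsCol (N := N) b x| :=
          Finset.abs_sum_le_sum_abs _ _
      _ ≤ ∑ b ∈ S, |a b| * C := Finset.sum_le_sum fun b _ => by
          rw [abs_mul]
          exact mul_le_mul_of_nonneg_left (hbdd _ x) (abs_nonneg _)
  have hFF : ∀ b b' : AffineAveraging.Site (d + 1), ∀ μ,
      Summable (fun x => dz (GsCol (N := N) b) μ x * dz (GsCol (N := N) b') μ x) :=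
    fun b b' μ => summable_mul_of_bdd (abs_dz_le (hbdd b) μ) (summable_dz (hsum b') μ)
  have hFW : ∀ b : AffineAveraging.Site (d + 1), ∀ μ,
      Summable (fun x => dz (GsCol (N := N) b) μ x * dz (GsColSum (N := N) S a) μ x) :=
    fun b μ => summable_mul_of_bdd' (summable_dz (hsum b) μ) (abs_dz_le hWb μ)
  have e1 : ∀ b ∈ S, ∑ b' ∈ S, a b * a b' * Gs (N := N) b b'
      = a b * lip1 (dz (GsCol (N := N) b)) (dz (GsColSum (N := N) S a)) := by
    intro b _
    rw [dz_GsColSum, lip1_sum_right S a _ _ (fun b' _ μ => hFF b b' μ), Finset.mul_sum]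
    refine Finset.sum_congr rfl fun b' _ => ?_
    rw [Gs_eq_lip1, lip1_comm]
    ring
  rw [Finset.sum_congr rfl e1, ← lip1_sum_left S a _ _ (fun b _ μ => hFW b μ), ← dz_GsColSum]
  exact tsum_nonneg fun x => Finset.sum_nonneg fun μ _ => mul_self_nonneg _

end Energy

/-! ## §4 Tempered uniqueness for the scalar system (polynomial Liouville in block coordinates) -/

/-- THE SCALAR KKT SYSTEM with force `F` and prescribed block sums `c`:
(ELₛ) `codiff₁ (dz λ) x = ω (quo N x) + F x`, (Mₛ) `blockSum N λ y = c y`. [folklore] -/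
structure SolvesS (N : ℕ) (F c lam ω : Form0 (d + 1) ℝ) : Prop where
  /-- (ELₛ). -/
  el : ∀ x, codiff₁ (dz lam) x = ω (quo N x) + F x
  /-- (Mₛ). -/
  mean : ∀ y, blockSum N lam y = c y

section Embed

variable [NeZero N]

/-- THE BLOCK CONFIGURATION OF A REAL PAIR `(λ, ω)`: block `y` carries the box values of `λ` on block `y` and `ω y`.
[folklore] -/
def cfgOfS (lam ω : Form0 (d + 1) ℝ) : CfgS (d + 1) N := fun y i =>
  match i with
  | Sum.inl z => ((lam (repZ z + (N : ℤ) • y) : ℝ) : ℂ)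
  | Sum.inr _ => ((ω y : ℝ) : ℂ)

omit [NeZero N] in
/-- EL-row entries of `cfgOfS`. [folklore] -/
@[simp] theorem cfgOfS_inl (lam ω : Form0 (d + 1) ℝ) (y : AffineAveraging.Site (d + 1)) (z : TorusSite (d + 1) N) :
    cfgOfS (N := N) lam ω y (Sum.inl z) = ((lam (repZ z + (N : ℤ) • y) : ℝ) : ℂ) := rfl

omit [NeZero N] in
/-- M-row entries of `cfgOfS`. [folklore] -/
@[simp] theorem cfgOfS_inr (lam ω : Form0 (d + 1) ℝ) (y : AffineAveraging.Site (d + 1)) (u : Unit) :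
    cfgOfS (N := N) lam ω y (Sum.inr u) = ((ω y : ℝ) : ℂ) := rfl

/-- The fine field read back from `cfgOfS λ ω` is `λ`. [folklore] -/
theorem cfgL_cfgOfS (lam ω : Form0 (d + 1) ℝ) : cfgL (cfgOfS (N := N) lam ω) = ofR0 lam := by
  funext x
  show ((lam (repZ (Torus.proj N x) + (N : ℤ) • quo N x) : ℝ) : ℂ) = ((lam x : ℝ) : ℂ)
  rw [← eq_repZ_add_zsmul_quo]

omit [NeZero N] in
/-- The multiplier read back from `cfgOfS λ ω` is `ω`. [folklore] -/
theorem cfgW_cfgOfS (lam ω : Form0 (d + 1) ℝ) : cfgW (cfgOfS (N := N) lam ω) = ofR0 ω := rfl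

/-- Two real pairs with the same configuration are equal. [folklore] -/
theorem eq_of_cfgOfS_eq {lam ω lam' ω' : Form0 (d + 1) ℝ} (h : cfgOfS (N := N) lam ω = cfgOfS (N := N) lam' ω') :
    lam = lam' ∧ ω = ω' := by
  refine ⟨?_, ?_⟩
  · funext x
    have e := congr_fun (congrArg cfgL h) x
    rw [cfgL_cfgOfS, cfgL_cfgOfS, ofR0_apply, ofR0_apply] at e
    exact_mod_cast e
  · funext y
    have e := congr_fun (congr_fun h y) (Sum.inr ())
    rw [cfgOfS_inr, cfgOfS_inr] at e
    exact_mod_cast e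

end Embed

section Residual

variable [NeZero N]

/-- EL rows of the block residual of `cfgOfS λ ω`, from the real fields. [folklore] -/
theorem residS_cfgOfS_inl (lam ω : Form0 (d + 1) ℝ) (y : AffineAveraging.Site (d + 1)) (z : TorusSite (d + 1) N) :
    cfgFunS (shiftCfgS (cfgOfS (N := N) lam ω) y) (Sum.inl z)
      = (((codiff₁ (dz lam) (repZ z + (N : ℤ) • y) - ω y : ℝ)) : ℂ) := by
  rw [cfgFunS_shiftCfgS_inl, cfgL_cfgOfS, cfgW_cfgOfS, dz_ofR0, codiff₁_ofR1]
  simp only [ofR0_apply]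
  push_cast
  ring

/-- M rows of the block residual of `cfgOfS λ ω`. [folklore] -/
theorem residS_cfgOfS_inr (lam ω : Form0 (d + 1) ℝ) (y : AffineAveraging.Site (d + 1)) (u : Unit) :
    cfgFunS (shiftCfgS (cfgOfS (N := N) lam ω) y) (Sum.inr u) = (((blockSum N lam y : ℝ)) : ℂ) := by
  rw [cfgFunS_shiftCfgS_inr, cfgL_cfgOfS, blockSum_ofR0, ofR0_apply]

/-- THE RESIDUAL OF A SOLUTION depends on `(F, c)` alone. [folklore] -/
def residOfS (F c : Form0 (d + 1) ℝ) (y : AffineAveraging.Site (d + 1)) : IdxS (d + 1) N → ℂ := fun i =>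
  match i with
  | Sum.inl z => ((F (repZ z + (N : ℤ) • y) : ℝ) : ℂ)
  | Sum.inr _ => ((c y : ℝ) : ℂ)

/-- The block residual of the configuration of a solution is `residOfS F c`. [folklore] -/
theorem cfgFunS_cfgOfS_of_solvesS {F c lam ω : Form0 (d + 1) ℝ} (h : SolvesS N F c lam ω)
    (y : AffineAveraging.Site (d + 1)) : cfgFunS (shiftCfgS (cfgOfS (N := N) lam ω) y) = residOfS (N := N) F c y := by
  funext i
  rcases i with z | u
  · rw [residS_cfgOfS_inl, h.el, quo_add_zsmul, quo_repZ, zero_add]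
    show _ = ((F (repZ z + (N : ℤ) • y) : ℝ) : ℂ)
    push_cast
    ring
  · rw [residS_cfgOfS_inr, h.mean]
    rfl

/-- In block coordinates the scalar KKT operator IS `FibreLiouville.stencilApply (stencil (d+1)) pieceMatrixS`.
[folklore] -/
theorem stencilApply_eq_cfgFunS (U : CfgS (d + 1) N) (y : AffineAveraging.Site (d + 1)) :
    stencilApply (stencil (d + 1)) (pieceMatrixS (N := N)) U y = cfgFunS (shiftCfgS U y) := by
  rw [cfgFunS_shiftCfgS_eq_sum]
  rfl

/-- **TEMPERED PAIRS GIVE POLYNOMIALLY BOUNDED CONFIGURATIONS.** [folklore] -/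
theorem polyBdd_cfgOfS {lam ω : Form0 (d + 1) ℝ} (hlam : Tempered0 lam) (hω : Tempered0 ω) :
    PolyBdd (cfgOfS (N := N) lam ω) := by
  obtain ⟨C₁, m₁, h₁⟩ := hlam
  obtain ⟨C₂, m₂, h₂⟩ := hω
  have hK1 : (1 : ℝ) ≤ 1 + (N : ℝ) * (d + 2) := by
    have : (0 : ℝ) ≤ (N : ℝ) * (d + 2) := by positivity
    linarith
  refine ⟨(|C₁| + |C₂|) * (1 + (N : ℝ) * (d + 2)) ^ (m₁ + m₂), m₁ + m₂, fun y i => ?_⟩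
  have hy : 1 ≤ 1 + l1 y := one_le_one_add_l1 y
  have key : ∀ (C : ℝ) (m : ℕ) (t : ℝ), m ≤ m₁ + m₂ → 1 ≤ t → t ≤ (1 + (N : ℝ) * (d + 2)) * (1 + l1 y) →
      C * t ^ m ≤ |C| * ((1 + (N : ℝ) * (d + 2)) ^ (m₁ + m₂) * (1 + l1 y) ^ (m₁ + m₂)) := by
    intro C m t hm ht htK
    calc C * t ^ m ≤ |C| * t ^ m := mul_le_mul_of_nonneg_right (le_abs_self C) (pow_nonneg (by linarith) _)
      _ ≤ |C| * ((1 + (N : ℝ) * (d + 2)) * (1 + l1 y)) ^ m :=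
          mul_le_mul_of_nonneg_left (pow_le_pow_left₀ (by linarith) htK m) (abs_nonneg C)
      _ ≤ |C| * ((1 + (N : ℝ) * (d + 2)) * (1 + l1 y)) ^ (m₁ + m₂) :=
          mul_le_mul_of_nonneg_left (pow_le_pow_right₀ (by nlinarith) hm) (abs_nonneg C)
      _ = |C| * ((1 + (N : ℝ) * (d + 2)) ^ (m₁ + m₂) * (1 + l1 y) ^ (m₁ + m₂)) := by rw [mul_pow]
  have hX : 0 ≤ (1 + (N : ℝ) * (d + 2)) ^ (m₁ + m₂) * (1 + l1 y) ^ (m₁ + m₂) := by positivity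
  have fin : ∀ C : ℝ, |C| ≤ |C₁| + |C₂| →
      |C| * ((1 + (N : ℝ) * (d + 2)) ^ (m₁ + m₂) * (1 + l1 y) ^ (m₁ + m₂))
        ≤ (|C₁| + |C₂|) * (1 + (N : ℝ) * (d + 2)) ^ (m₁ + m₂) * (1 + l1 y) ^ (m₁ + m₂) := by
    intro C hC
    rw [mul_assoc]
    exact mul_le_mul_of_nonneg_right hC hX
  rcases i with z | u
  · rw [cfgOfS_inl, Complex.norm_real, Real.norm_eq_abs]
    exact ((h₁ _).trans (key C₁ m₁ _ (by omega) (one_le_one_add_l1 _) (one_add_l1_fine_le z y))).trans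
      (fin C₁ (by linarith [abs_nonneg C₂]))
  · rw [cfgOfS_inr, Complex.norm_real, Real.norm_eq_abs]
    exact ((h₂ y).trans (key C₂ m₂ _ (by omega) hy (by nlinarith))).trans
      (fin C₂ (by linarith [abs_nonneg C₁]))

end Residual

section Unique

variable [NeZero N]

/-- **UNIQUENESS OF TEMPERED SOLUTIONS OF THE SCALAR SYSTEM**: two tempered pairs solving (ELₛ), (Mₛ) with the same
force and the same block sums are equal. [folklore] -/
theorem unique_of_solvesS {F c lam ω lam' ω' : Form0 (d + 1) ℝ} (h : SolvesS N F c lam ω) (h' : SolvesS N F c lam' ω')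
    (hlam : Tempered0 lam) (hω : Tempered0 ω) (hlam' : Tempered0 lam') (hω' : Tempered0 ω') :
    lam = lam' ∧ ω = ω' := by
  have heq : stencilApply (stencil (d + 1)) (pieceMatrixS (N := N)) (cfgOfS (N := N) lam ω)
      = stencilApply (stencil (d + 1)) (pieceMatrixS (N := N)) (cfgOfS (N := N) lam' ω') := by
    funext y
    rw [stencilApply_eq_cfgFunS, stencilApply_eq_cfgFunS, cfgFunS_cfgOfS_of_solvesS h, cfgFunS_cfgOfS_of_solvesS h']
  exact eq_of_cfgOfS_eq (eq_of_stencilApply_eq _ _ (fun s _ => det_trigPolySymbolS_ne_zero s)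
    (polyBdd_cfgOfS hlam hω) (polyBdd_cfgOfS hlam' hω') heq)

end Unique

/-! ## §5 The scalar Green kernel is THE tempered solution with a unit force and zero block sums -/

section Canonical

variable [NeZero N]

/-- The coarse multiplier column `y ↦ Ws y x'`. [folklore] -/
def WsCol (x' : AffineAveraging.Site (d + 1)) : Form0 (d + 1) ℝ := fun y => Ws (N := N) y x'

/-- The column `(G_{x'}, W_{x'})` solves the scalar system with the unit force at `x'` and zero block sums. [folklore] -/
theorem solvesS_GsCol (x' : AffineAveraging.Site (d + 1)) : SolvesS N (δS x') 0 (GsCol (N := N) x') (WsCol (N := N) x') where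
  el x := Gs_EL (N := N) x' x
  mean y := Gs_M (N := N) x' y

/-- `G_{x'}` is bounded, hence tempered. [folklore] -/
theorem tempered_GsCol (x' : AffineAveraging.Site (d + 1)) : Tempered0 (GsCol (N := N) x') := by
  obtain ⟨C, _, hbdd, _⟩ := GsCol_bdd_summable (N := N) (d := d)
  exact Tempered0.of_bounded (hbdd x')

/-- `W_{x'}` is bounded, hence tempered. [folklore] -/
theorem tempered_WsCol (x' : AffineAveraging.Site (d + 1)) : Tempered0 (WsCol (N := N) x') := by
  obtain ⟨δ, C, hδ, _, h⟩ := decay_wS (N := N) (d := d)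
  refine Tempered0.of_bounded (B := C) fun y => ?_
  have hb := abs_le_of_decay510 hδ (h (Torus.proj N x')) (y - quo N x')
  exact hb

/-- **THE SCALAR GREEN KERNEL IS CANONICAL**: every TEMPERED pair solving the scalar system with the unit force at `x'`
and zero block sums is `(G_{x'}, W_{x'})`. [folklore] -/
theorem eq_GsCol_of_solvesS {x' : AffineAveraging.Site (d + 1)} {lam ω : Form0 (d + 1) ℝ}
    (h : SolvesS N (δS x') 0 lam ω) (hlam : Tempered0 lam) (hω : Tempered0 ω) :
    lam = GsCol (N := N) x' ∧ ω = WsCol (N := N) x' :=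
  unique_of_solvesS h (solvesS_GsCol x') hlam hω (tempered_GsCol x') (tempered_WsCol x')

/-- In particular the fine field ALONE of any tempered solution is `Gs(·, x')`. [folklore] -/
theorem eq_Gs_of_solvesS {x' : AffineAveraging.Site (d + 1)} {lam ω : Form0 (d + 1) ℝ}
    (h : SolvesS N (δS x') 0 lam ω) (hlam : Tempered0 lam) (hω : Tempered0 ω) (x : AffineAveraging.Site (d + 1)) :
    lam x = Gs (N := N) x x' := by
  rw [(eq_GsCol_of_solvesS h hlam hω).1]
  rfl

end Canonical

end

end Literature.MathematicalPhysics.QuantumFieldTheory.Balaban1983to89.Beta.ScalarBlockGreen
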